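import Literature.Geometry.Riemannian.SphericalCylinderEntropyGegenbauerODE
import Literature.Geometry.Riemannian.SphericalZonalKernelSeriesDeriv
import Mathlib.Analysis.Calculus.SmoothSeries
import HarnessLib

/-!
# The typed zonal heat kernel of `S⁴` solves the zonal heat equation

Topic `Literature/Geometry/Riemannian`; continuation of `SphericalCylinderEntropy.lean`,
`SphericalCylinderEntropySmallScales.lean` and `SphericalCylinderEntropyGegenbauerODE.lean`.
The typed kernel of route `SmoothPoincare4/CylinderEntropy` is built from the series
`zonal τ s = 𝔥(τ, s) = ∑_k wt k τ · gegen k s`, `wt k τ = e^{-k(k+3)τ} (2k+3)/3`,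
`gegen k = C_k^{(3/2)}` (explicit sums).  With the Gegenbauer equation
`(1 - s²) C_k'' - 4 s C_k' = -k(k+3) C_k` (`gegen_eigen`) every mode `wt k τ · C_k(s)` solves the
zonal heat equation of `S⁴`, `∂_τ u = (1 - s²) ∂_s² u - 4 s ∂_s u` (the right-hand side is `Δ_{S⁴}`
on functions of `s = cos θ = ⟨z', p'⟩`), and this file justifies the term-wise differentiation of the
series at every `τ > 0` and EVERY real `s` (the modes are polynomials and the Gaussian weights beat
any exponential `C^k`).  Proved here (everything; no facts, no definitions):

* `summable_exp_mul_pow_of_pos` — `∑_k e^{-k(k+3)τ} C^k < ∞` for `τ > 0`, `C ≥ 0`;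
* `abs_wt_mul_gegen_le`, `abs_wt_mul_deriv_gegen_le`, `abs_wt_mul_deriv_deriv_gegen_le`,
  `abs_dwt_mul_gegen_le` — majorants `e^{-k(k+3)τ} (cR)^k` (`c = 64, 128, 256`) for the modes, their
  first two `s`-derivatives and their `τ`-derivative on `|s| ≤ R`, `R ≥ 1`;
* `hasDerivAt_wt`, `mode_heat_equation` — `∂_τ wt = -k(k+3) wt` and the mode-wise heat equation;
* `hasSum_zonal_real` — the series sums to `zonal` for every real `s` (not only `|s| ≤ 1`) at every
  `τ > 0` (absolute convergence: the tree's `SphericalZonalKernelSeries.summable_wt_mul_gegen`);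
* `hasDerivAt_zonal_tsum`, `deriv_zonal_eq_tsum`, `hasDerivAt_deriv_zonal_tsum`,
  `deriv_deriv_zonal_eq_tsum` — term-wise first and second `s`-derivatives of `𝔥(τ, ·)` on all of `ℝ`
  (the tree's `SphericalZonalKernelSeriesDeriv.hasDerivAt_zonal` writes the first one as
  `5 e^{-4τ} zonalSix`; here both stay inside the `S⁴` series, as the heat equation needs);
* `hasDerivAt_zonal_tau`, `deriv_zonal_tau` — term-wise `τ`-derivative on `(0, ∞)`;
* `zonal_heat_equation` — **`∂_τ 𝔥 = (1 - s²) ∂_s² 𝔥 - 4 s ∂_s 𝔥` on `(0, ∞) × ℝ`**: the typed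
  zonal kernel (`= vol(S⁴) · H_{S⁴}` in the variable `s = ⟨z', p'⟩`) solves the heat equation of `S⁴`
  — ingredient (ii) of Hamilton's monotonicity formula for the typed density (crux `CylinderRungTwo`,
  stub `stub_hamiltonMonotonicity`).

## References
* NIST Digital Library of Mathematical Functions, §18.8 (Gegenbauer equation).
* R. S. Hamilton, *A matrix Harnack estimate for the heat equation*, Comm. Anal. Geom. 1 (1993),
  113–126; *Monotonicity formulas for parabolic flows on manifolds*, ibid. 127–137.
-/

noncomputable section

open scoped BigOperators Topology
open Filter Set Finset Literature.Geometry.Riemannian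

namespace Literature.Geometry.Riemannian.SphericalCylinderEntropy

/-! ### Elementary growth bounds and the general Gaussian majorant -/

/-- `2k ≤ 2^k` (from core's `k < 2^k`). [folklore] -/
theorem two_mul_cast_le_two_pow (k : ℕ) : 2 * (k : ℝ) ≤ 2 ^ k := by
  rcases Nat.eq_zero_or_pos k with rfl | hk
  · norm_num
  · obtain ⟨n, rfl⟩ : ∃ n, k = n + 1 := ⟨k - 1, by omega⟩
    have h : ((n + 1 : ℕ) : ℝ) ≤ ((2 ^ n : ℕ) : ℝ) := by exact_mod_cast n.lt_two_pow_self
    push_cast at h ⊢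
    rw [pow_succ]
    linarith

/-- `k (k + 3) ≤ 4 · 4^k`. [folklore] -/
theorem cast_mul_add_three_le (k : ℕ) : (k : ℝ) * ((k : ℝ) + 3) ≤ 4 * 4 ^ k := by
  have h : ((k + 1 : ℕ) : ℝ) ≤ ((2 ^ k : ℕ) : ℝ) := by exact_mod_cast k.lt_two_pow_self
  push_cast at h
  have h1 : (k : ℝ) ≤ 2 ^ k := by linarith
  have h2 : (k : ℝ) + 3 ≤ 4 * 2 ^ k := by linarith
  have h4 : (4 : ℝ) ^ k = 2 ^ k * 2 ^ k := by rw [← mul_pow]; norm_num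
  rw [h4]
  calc (k : ℝ) * ((k : ℝ) + 3) ≤ 2 ^ k * (4 * 2 ^ k) :=
        mul_le_mul h1 h2 (by positivity) (by positivity)
    _ = 4 * (2 ^ k * 2 ^ k) := by ring

/-- **The Gaussian weights beat every exponential**: `∑_k e^{-k(k+3)τ} C^k < ∞` for `τ > 0`, `C ≥ 0`
(once `k τ ≥ 2C`, `e^{(k+3)τ} ≥ (k+3)τ + 1 ≥ 2C`, so the `k`-th term is `≤ 2^{-k}`). [folklore] -/
theorem summable_exp_mul_pow_of_pos {τ : ℝ} (hτ : 0 < τ) {C : ℝ} (hC : 0 ≤ C) :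
    Summable fun k : ℕ => Real.exp (-((k : ℝ) * ((k : ℝ) + 3)) * τ) * C ^ k := by
  refine Summable.of_norm_bounded_eventually_nat (g := fun k : ℕ => (1 / 2 : ℝ) ^ k)
    (summable_geometric_of_lt_one (by norm_num) (by norm_num)) ?_
  rw [Filter.eventually_atTop]
  refine ⟨⌈2 * C / τ⌉₊, fun k hk => ?_⟩
  have hk' : 2 * C / τ ≤ (k : ℝ) := Nat.ceil_le.1 hk
  have hkτ : 2 * C ≤ (k : ℝ) * τ := by rwa [div_le_iff₀ hτ] at hk'
  rw [Real.norm_eq_abs, abs_of_nonneg (by positivity)]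
  have hexp : 2 * C ≤ Real.exp (((k : ℝ) + 3) * τ) := by
    have h := Real.add_one_le_exp (((k : ℝ) + 3) * τ)
    nlinarith
  have hsmall : Real.exp (-(((k : ℝ) + 3) * τ)) * C ≤ 1 / 2 := by
    rw [Real.exp_neg, inv_mul_le_iff₀ (Real.exp_pos _)]
    linarith
  have hrew : Real.exp (-((k : ℝ) * ((k : ℝ) + 3)) * τ) * C ^ k =
      (Real.exp (-(((k : ℝ) + 3) * τ)) * C) ^ k := by
    rw [mul_pow, ← Real.exp_nat_mul]
    congr 1
    congr 1
    ring
  rw [hrew]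
  exact pow_le_pow_left₀ (by positivity) hsmall k

/-- The Gaussian factor is non-increasing in the scale. [folklore] -/
theorem exp_weight_antitone (k : ℕ) {τ₀ τ : ℝ} (h : τ₀ ≤ τ) :
    Real.exp (-((k : ℝ) * ((k : ℝ) + 3)) * τ) ≤ Real.exp (-((k : ℝ) * ((k : ℝ) + 3)) * τ₀) := by
  refine Real.exp_le_exp.2 ?_
  have h0 : (0 : ℝ) ≤ (k : ℝ) * ((k : ℝ) + 3) := by positivity
  nlinarith

/-! ### Majorants for the modes and their derivatives on `|s| ≤ R` -/

/-- `|wt k τ · x| = e^{-k(k+3)τ} (2k+3)/3 · |x|`. [folklore] -/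
theorem abs_wt_mul (k : ℕ) (τ x : ℝ) :
    |wt k τ * x| = Real.exp (-((k : ℝ) * ((k : ℝ) + 3)) * τ) * ((2 * (k : ℝ) + 3) / 3 * |x|) := by
  rw [abs_mul, abs_of_pos (wt_pos k τ), wt, mul_assoc]

/-- **Mode majorant**: `|wt k τ · C_k(s)| ≤ e^{-k(k+3)τ} (64R)^k` for `|s| ≤ R`, `R ≥ 1`. [folklore] -/
theorem abs_wt_mul_gegen_le (k : ℕ) (τ : ℝ) {R s : ℝ} (hR : 1 ≤ R) (hs : |s| ≤ R) :
    |wt k τ * gegen k s| ≤ Real.exp (-((k : ℝ) * ((k : ℝ) + 3)) * τ) * (64 * R) ^ k := by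
  rw [abs_wt_mul]
  refine mul_le_mul_of_nonneg_left ?_ (Real.exp_pos _).le
  have h64 : (64 * R) ^ k = 8 ^ k * (8 * R) ^ k := by rw [← mul_pow]; ring
  calc (2 * (k : ℝ) + 3) / 3 * |gegen k s|
      ≤ (2 * (k : ℝ) + 3) / 3 * (((k : ℝ) + 1) ^ 2 * (8 * R) ^ k) :=
        mul_le_mul_of_nonneg_left (abs_gegen_le_of_abs_le k hR hs) (by positivity)
    _ = ((2 * (k : ℝ) + 3) / 3 * ((k : ℝ) + 1) ^ 2) * (8 * R) ^ k := by ring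
    _ ≤ 8 ^ k * (8 * R) ^ k := mul_le_mul_of_nonneg_right (wtPoly_le_eight_pow k) (by positivity)
    _ = (64 * R) ^ k := h64.symm

/-- **First-derivative majorant**: `|wt k τ · C_k'(s)| ≤ e^{-k(k+3)τ} (128R)^k` for `|s| ≤ R`, `R ≥ 1`.
[folklore] -/
theorem abs_wt_mul_deriv_gegen_le (k : ℕ) (τ : ℝ) {R s : ℝ} (hR : 1 ≤ R) (hs : |s| ≤ R) :
    |wt k τ * deriv (gegen k) s| ≤ Real.exp (-((k : ℝ) * ((k : ℝ) + 3)) * τ) * (128 * R) ^ k := by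
  rw [abs_wt_mul]
  refine mul_le_mul_of_nonneg_left ?_ (Real.exp_pos _).le
  have h128 : (128 * R) ^ k = 2 ^ k * 8 ^ k * (8 * R) ^ k := by
    rw [← mul_pow, ← mul_pow]; ring
  have h2k := two_mul_cast_le_two_pow k
  have h8 := wtPoly_le_eight_pow k
  calc (2 * (k : ℝ) + 3) / 3 * |deriv (gegen k) s|
      ≤ (2 * (k : ℝ) + 3) / 3 * (2 * (k : ℝ) * ((k : ℝ) + 1) ^ 2 * (8 * R) ^ k) :=
        mul_le_mul_of_nonneg_left (abs_deriv_gegen_le_of_abs_le k hR hs) (by positivity)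
    _ = (2 * (k : ℝ)) * ((2 * (k : ℝ) + 3) / 3 * ((k : ℝ) + 1) ^ 2) * (8 * R) ^ k := by ring
    _ ≤ 2 ^ k * 8 ^ k * (8 * R) ^ k := by
        refine mul_le_mul_of_nonneg_right ?_ (by positivity)
        exact mul_le_mul h2k h8 (by positivity) (by positivity)
    _ = (128 * R) ^ k := h128.symm

/-- **Second-derivative majorant**: `|wt k τ · C_k''(s)| ≤ e^{-k(k+3)τ} (256R)^k` for `|s| ≤ R`,
`R ≥ 1`. [folklore] -/
theorem abs_wt_mul_deriv_deriv_gegen_le (k : ℕ) (τ : ℝ) {R s : ℝ} (hR : 1 ≤ R) (hs : |s| ≤ R) :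
    |wt k τ * deriv (deriv (gegen k)) s| ≤
      Real.exp (-((k : ℝ) * ((k : ℝ) + 3)) * τ) * (256 * R) ^ k := by
  rw [abs_wt_mul]
  refine mul_le_mul_of_nonneg_left ?_ (Real.exp_pos _).le
  have h256 : (256 * R) ^ k = (2 ^ k * 2 ^ k) * 8 ^ k * (8 * R) ^ k := by
    rw [← mul_pow, ← mul_pow, ← mul_pow]; ring
  have h2k := two_mul_cast_le_two_pow k
  have h8 := wtPoly_le_eight_pow k
  have h4k : 4 * (k : ℝ) ^ 2 ≤ 2 ^ k * 2 ^ k := by nlinarith [h2k, (Nat.cast_nonneg k : (0 : ℝ) ≤ k)]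
  calc (2 * (k : ℝ) + 3) / 3 * |deriv (deriv (gegen k)) s|
      ≤ (2 * (k : ℝ) + 3) / 3 * (4 * (k : ℝ) ^ 2 * ((k : ℝ) + 1) ^ 2 * (8 * R) ^ k) :=
        mul_le_mul_of_nonneg_left (abs_deriv_deriv_gegen_le_of_abs_le k hR hs) (by positivity)
    _ = (4 * (k : ℝ) ^ 2) * ((2 * (k : ℝ) + 3) / 3 * ((k : ℝ) + 1) ^ 2) * (8 * R) ^ k := by ring
    _ ≤ (2 ^ k * 2 ^ k) * 8 ^ k * (8 * R) ^ k := by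
        refine mul_le_mul_of_nonneg_right ?_ (by positivity)
        exact mul_le_mul h4k h8 (by positivity) (by positivity)
    _ = (256 * R) ^ k := h256.symm

/-- **`τ`-derivative majorant**: `|k(k+3) · wt k τ · C_k(s)| ≤ 4 e^{-k(k+3)τ} (256R)^k` for `|s| ≤ R`,
`R ≥ 1`. [folklore] -/
theorem abs_dwt_mul_gegen_le (k : ℕ) (τ : ℝ) {R s : ℝ} (hR : 1 ≤ R) (hs : |s| ≤ R) :
    |-((k : ℝ) * ((k : ℝ) + 3)) * wt k τ * gegen k s| ≤
      4 * (Real.exp (-((k : ℝ) * ((k : ℝ) + 3)) * τ) * (256 * R) ^ k) := by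
  rw [mul_assoc, abs_mul, abs_neg, abs_of_nonneg (by positivity : (0 : ℝ) ≤ (k : ℝ) * ((k : ℝ) + 3))]
  have h := abs_wt_mul_gegen_le k τ hR hs
  have hk := cast_mul_add_three_le k
  have h256 : (256 * R) ^ k = 4 ^ k * (64 * R) ^ k := by rw [← mul_pow]; ring
  rw [h256]
  calc (k : ℝ) * ((k : ℝ) + 3) * |wt k τ * gegen k s|
      ≤ (4 * 4 ^ k) * (Real.exp (-((k : ℝ) * ((k : ℝ) + 3)) * τ) * (64 * R) ^ k) :=
        mul_le_mul hk h (abs_nonneg _) (by positivity)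
    _ = _ := by ring

/-! ### The modes: `τ`-derivative of the weights and the mode-wise heat equation -/

/-- `∂_τ wt k τ = -k(k+3) · wt k τ`. [folklore] -/
theorem hasDerivAt_wt (k : ℕ) (τ : ℝ) :
    HasDerivAt (wt k) (-((k : ℝ) * ((k : ℝ) + 3)) * wt k τ) τ := by
  have h := (((hasDerivAt_id' τ).const_mul (-((k : ℝ) * ((k : ℝ) + 3)))).exp).mul_const
    ((2 * (k : ℝ) + 3) / 3)
  unfold wt
  refine (h.congr_deriv ?_).congr_of_eventuallyEq (Filter.Eventually.of_forall fun x => by simp)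
  simp only [mul_one]
  ring

/-- `τ ↦ wt k τ` as a `deriv`. [folklore] -/
theorem deriv_wt (k : ℕ) (τ : ℝ) : deriv (wt k) τ = -((k : ℝ) * ((k : ℝ) + 3)) * wt k τ :=
  (hasDerivAt_wt k τ).deriv

/-- **Mode-wise heat equation**: `u_k(τ, s) = wt k τ · C_k(s)` satisfies
`∂_τ u_k = (1 - s²) ∂_s² u_k - 4 s ∂_s u_k` (both sides equal `-k(k+3) u_k`, by `gegen_eigen`).
[folklore] -/
theorem mode_heat_equation (k : ℕ) (τ s : ℝ) :
    deriv (fun τ => wt k τ * gegen k s) τ =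
      (1 - s ^ 2) * deriv (deriv (fun s => wt k τ * gegen k s)) s
        - 4 * s * deriv (fun s => wt k τ * gegen k s) s := by
  have h1 : deriv (fun τ => wt k τ * gegen k s) τ = -((k : ℝ) * ((k : ℝ) + 3)) * wt k τ * gegen k s := by
    rw [((hasDerivAt_wt k τ).mul_const (gegen k s)).deriv, mul_assoc]
  have h2 : deriv (fun s => wt k τ * gegen k s) = fun s => wt k τ * deriv (gegen k) s := by
    funext x
    exact ((differentiable_gegen k x).hasDerivAt.const_mul (wt k τ)).deriv
  have h3 : deriv (fun s => wt k τ * deriv (gegen k) s) s = wt k τ * deriv (deriv (gegen k)) s :=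
    ((differentiable_deriv_gegen k s).hasDerivAt.const_mul (wt k τ)).deriv
  rw [h1, h2, h3]
  linear_combination (wt k τ) * (gegen_eigen k s).symm

/-! ### The series at every real `s` -/

/-- The typed zonal kernel is the sum of its series at every real `s`, `τ > 0` (absolute
convergence for all real `s` is the tree's `SphericalZonalKernelSeries.summable_wt_mul_gegen`; the
majorant `e^{-k(k+3)τ} (64R)^k` above gives it again). [folklore] -/
theorem hasSum_zonal_real {τ : ℝ} (hτ : 0 < τ) (s : ℝ) :
    HasSum (fun k : ℕ => wt k τ * gegen k s) (zonal τ s) :=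
  (SphericalZonalKernelSeries.summable_wt_mul_gegen hτ s).hasSum

/-- Summability of the first-derivative series for every real `s`, `τ > 0`. [folklore] -/
theorem summable_wt_mul_deriv_gegen {τ : ℝ} (hτ : 0 < τ) (s : ℝ) :
    Summable fun k : ℕ => wt k τ * deriv (gegen k) s := by
  have hR : (1 : ℝ) ≤ |s| + 1 := by linarith [abs_nonneg s]
  refine Summable.of_norm_bounded (summable_exp_mul_pow_of_pos hτ (C := 128 * (|s| + 1))
    (by positivity)) fun k => ?_
  rw [Real.norm_eq_abs]
  exact abs_wt_mul_deriv_gegen_le k τ hR (by linarith)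

/-- Summability of the second-derivative series for every real `s`, `τ > 0`. [folklore] -/
theorem summable_wt_mul_deriv_deriv_gegen {τ : ℝ} (hτ : 0 < τ) (s : ℝ) :
    Summable fun k : ℕ => wt k τ * deriv (deriv (gegen k)) s := by
  have hR : (1 : ℝ) ≤ |s| + 1 := by linarith [abs_nonneg s]
  refine Summable.of_norm_bounded (summable_exp_mul_pow_of_pos hτ (C := 256 * (|s| + 1))
    (by positivity)) fun k => ?_
  rw [Real.norm_eq_abs]
  exact abs_wt_mul_deriv_deriv_gegen_le k τ hR (by linarith)

/-- Summability of the `τ`-derivative series for every real `s`, `τ > 0`. [folklore] -/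
theorem summable_dwt_mul_gegen {τ : ℝ} (hτ : 0 < τ) (s : ℝ) :
    Summable fun k : ℕ => -((k : ℝ) * ((k : ℝ) + 3)) * wt k τ * gegen k s := by
  have hR : (1 : ℝ) ≤ |s| + 1 := by linarith [abs_nonneg s]
  refine Summable.of_norm_bounded ((summable_exp_mul_pow_of_pos hτ (C := 256 * (|s| + 1))
    (by positivity)).mul_left 4) fun k => ?_
  rw [Real.norm_eq_abs]
  exact abs_dwt_mul_gegen_le k τ hR (by linarith)

/-! ### Term-wise derivatives of the typed zonal kernel -/

/-- **First `s`-derivative of `𝔥(τ, ·)`, term-wise, at every real `s`** (`τ > 0`):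
`∂_s 𝔥(τ, s) = ∑_k wt k τ · C_k'(s)` (uniform majorant `e^{-k(k+3)τ} (128R)^k` on `(-R, R)`,
`R = |s| + 1`). [folklore] -/
theorem hasDerivAt_zonal_tsum {τ : ℝ} (hτ : 0 < τ) (s : ℝ) :
    HasDerivAt (zonal τ) (∑' k : ℕ, wt k τ * deriv (gegen k) s) s := by
  set R : ℝ := |s| + 1 with hRdef
  have hR : (1 : ℝ) ≤ R := by rw [hRdef]; linarith [abs_nonneg s]
  have hsR : s ∈ Set.Ioo (-R) R := by
    rw [hRdef]; constructor <;> linarith [neg_abs_le s, le_abs_self s]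
  have hbound : ∀ y ∈ Set.Ioo (-R) R, |y| ≤ R := fun y hy => abs_le.2 ⟨hy.1.le, hy.2.le⟩
  have h := hasDerivAt_tsum_of_isPreconnected (g := fun (k : ℕ) (y : ℝ) => wt k τ * gegen k y)
    (g' := fun (k : ℕ) (y : ℝ) => wt k τ * deriv (gegen k) y) (t := Set.Ioo (-R) R) (y₀ := s)
    (summable_exp_mul_pow_of_pos hτ (C := 128 * R) (by positivity)) isOpen_Ioo isPreconnected_Ioo
    (fun k y _ => ((differentiable_gegen k y).hasDerivAt.const_mul (wt k τ)))
    (fun k y hy => by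
      rw [Real.norm_eq_abs]
      exact abs_wt_mul_deriv_gegen_le k τ hR (hbound y hy))
    hsR (SphericalZonalKernelSeries.summable_wt_mul_gegen hτ s) hsR
  exact h

/-- `∂_s 𝔥(τ, ·)` as a function (`τ > 0`). [folklore] -/
theorem deriv_zonal_eq_tsum {τ : ℝ} (hτ : 0 < τ) :
    deriv (zonal τ) = fun s => ∑' k : ℕ, wt k τ * deriv (gegen k) s :=
  funext fun s => (hasDerivAt_zonal_tsum hτ s).deriv

/-- **Second `s`-derivative of `𝔥(τ, ·)`, term-wise, at every real `s`** (`τ > 0`):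
`∂_s² 𝔥(τ, s) = ∑_k wt k τ · C_k''(s)`. [folklore] -/
theorem hasDerivAt_deriv_zonal_tsum {τ : ℝ} (hτ : 0 < τ) (s : ℝ) :
    HasDerivAt (deriv (zonal τ)) (∑' k : ℕ, wt k τ * deriv (deriv (gegen k)) s) s := by
  set R : ℝ := |s| + 1 with hRdef
  have hR : (1 : ℝ) ≤ R := by rw [hRdef]; linarith [abs_nonneg s]
  have hsR : s ∈ Set.Ioo (-R) R := by
    rw [hRdef]; constructor <;> linarith [neg_abs_le s, le_abs_self s]
  have hbound : ∀ y ∈ Set.Ioo (-R) R, |y| ≤ R := fun y hy => abs_le.2 ⟨hy.1.le, hy.2.le⟩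
  rw [deriv_zonal_eq_tsum hτ]
  exact hasDerivAt_tsum_of_isPreconnected (g := fun (k : ℕ) (y : ℝ) => wt k τ * deriv (gegen k) y)
    (g' := fun (k : ℕ) (y : ℝ) => wt k τ * deriv (deriv (gegen k)) y) (t := Set.Ioo (-R) R) (y₀ := s)
    (summable_exp_mul_pow_of_pos hτ (C := 256 * R) (by positivity)) isOpen_Ioo isPreconnected_Ioo
    (fun k y _ => ((differentiable_deriv_gegen k y).hasDerivAt.const_mul (wt k τ)))
    (fun k y hy => by
      rw [Real.norm_eq_abs]
      exact abs_wt_mul_deriv_deriv_gegen_le k τ hR (hbound y hy))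
    hsR (summable_wt_mul_deriv_gegen hτ s) hsR

/-- `∂_s² 𝔥(τ, ·)` as a function (`τ > 0`). [folklore] -/
theorem deriv_deriv_zonal_eq_tsum {τ : ℝ} (hτ : 0 < τ) :
    deriv (deriv (zonal τ)) = fun s => ∑' k : ℕ, wt k τ * deriv (deriv (gegen k)) s :=
  funext fun s => (hasDerivAt_deriv_zonal_tsum hτ s).deriv

/-- **`τ`-derivative of `𝔥(·, s)`, term-wise, on `(0, ∞)`** for every real `s`:
`∂_τ 𝔥(τ, s) = -∑_k k(k+3) wt k τ · C_k(s)` (uniform majorant `4 e^{-k(k+3)τ/2} (256R)^k` on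
`τ' > τ/2`). [folklore] -/
theorem hasDerivAt_zonal_tau {τ : ℝ} (hτ : 0 < τ) (s : ℝ) :
    HasDerivAt (fun τ' => zonal τ' s)
      (∑' k : ℕ, -((k : ℝ) * ((k : ℝ) + 3)) * wt k τ * gegen k s) τ := by
  set R : ℝ := |s| + 1 with hRdef
  have hR : (1 : ℝ) ≤ R := by rw [hRdef]; linarith [abs_nonneg s]
  have hsR : |s| ≤ R := by rw [hRdef]; linarith
  have hτ2 : 0 < τ / 2 := by positivity
  have hmem : τ ∈ Set.Ioi (τ / 2) := by rw [Set.mem_Ioi]; linarith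
  have h := hasDerivAt_tsum_of_isPreconnected (g := fun (k : ℕ) (τ' : ℝ) => wt k τ' * gegen k s)
    (g' := fun (k : ℕ) (τ' : ℝ) => -((k : ℝ) * ((k : ℝ) + 3)) * wt k τ' * gegen k s)
    (t := Set.Ioi (τ / 2)) (y₀ := τ)
    ((summable_exp_mul_pow_of_pos hτ2 (C := 256 * R) (by positivity)).mul_left 4)
    isOpen_Ioi isPreconnected_Ioi
    (fun k τ' _ => by
      have h1 := (hasDerivAt_wt k τ').mul_const (gegen k s)
      exact h1)
    (fun k τ' hτ' => by
      rw [Real.norm_eq_abs]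
      refine (abs_dwt_mul_gegen_le k τ' hR hsR).trans ?_
      have hle : τ / 2 ≤ τ' := le_of_lt hτ'
      have := exp_weight_antitone k hle
      have h0 : (0 : ℝ) ≤ (256 * R) ^ k := by positivity
      nlinarith [mul_le_mul_of_nonneg_right this h0])
    hmem (SphericalZonalKernelSeries.summable_wt_mul_gegen hτ s) hmem
  simpa only [zonal] using h

/-- `∂_τ 𝔥(τ, s)` as a `deriv` (`τ > 0`). [folklore] -/
theorem deriv_zonal_tau {τ : ℝ} (hτ : 0 < τ) (s : ℝ) :
    deriv (fun τ' => zonal τ' s) τ = ∑' k : ℕ, -((k : ℝ) * ((k : ℝ) + 3)) * wt k τ * gegen k s :=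
  (hasDerivAt_zonal_tau hτ s).deriv

/-! ### The zonal heat equation -/

/-- **The typed zonal kernel solves the heat equation of `S⁴`**: for `τ > 0` and every real `s`,
`∂_τ 𝔥(τ, s) = (1 - s²) ∂_s² 𝔥(τ, s) - 4 s ∂_s 𝔥(τ, s)`; on `N = S⁴ × ℝ` with `s = ⟨z', p'⟩` the
right-hand side is `Δ_{S⁴}` of the zonal function `z' ↦ 𝔥(τ, ⟨z', p'⟩)`, so
`𝔥 = vol(S⁴) · H_{S⁴}(·, p'; τ)` is a genuine solution of `∂_τ 𝔥 = Δ_{S⁴} 𝔥` (term-wise by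
`mode_heat_equation` / `gegen_eigen`, the interchanges by the majorants above). [folklore] -/
theorem zonal_heat_equation {τ : ℝ} (hτ : 0 < τ) (s : ℝ) :
    deriv (fun τ' => zonal τ' s) τ =
      (1 - s ^ 2) * deriv (deriv (zonal τ)) s - 4 * s * deriv (zonal τ) s := by
  rw [deriv_zonal_tau hτ s, deriv_deriv_zonal_eq_tsum hτ, deriv_zonal_eq_tsum hτ]
  simp only []
  rw [← tsum_mul_left, ← tsum_mul_left, ← Summable.tsum_sub
    ((summable_wt_mul_deriv_deriv_gegen hτ s).mul_left _)
    ((summable_wt_mul_deriv_gegen hτ s).mul_left _)]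
  refine tsum_congr fun k => ?_
  linear_combination (wt k τ) * (gegen_eigen k s).symm

/-- The heat equation in `HasDerivAt` form: `τ' ↦ 𝔥(τ', s)` has derivative
`(1 - s²) ∂_s² 𝔥(τ, s) - 4 s ∂_s 𝔥(τ, s)` at `τ > 0`. [folklore] -/
theorem hasDerivAt_zonal_tau_heat {τ : ℝ} (hτ : 0 < τ) (s : ℝ) :
    HasDerivAt (fun τ' => zonal τ' s)
      ((1 - s ^ 2) * deriv (deriv (zonal τ)) s - 4 * s * deriv (zonal τ) s) τ := by
  rw [← zonal_heat_equation hτ s]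
  exact (hasDerivAt_zonal_tau hτ s).differentiableAt.hasDerivAt

end Literature.Geometry.Riemannian.SphericalCylinderEntropy

end
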